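import Literature.NumberTheory.LFunctions.SelbergDeltaAssembly
import HarnessLib

/-!
# The off-line sum integrated over `u ∈ [9T/8, 15T/8]`

Topic `Literature/NumberTheory/LFunctions`. Everything in this file is PROVED (no definitions, no
named facts).

The off-line term `D(u) = ∑_ρ m(ρ)(𝒜_ρ(u+h) − 𝒜_ρ(u))` of the main inequality
(`SelbergDeltaAssembly.lean`) is controlled in `L¹([9T/8, 15T/8])` zero by zero: with
`‖𝒜_ρ(t)‖ ≤ δ_ρ τ e^{τδ_ρ/4} D₀/(1 + τ²(γ − t)²)`, `δ_ρ = |β − 1/2|`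
(`Literature.NumberTheory.LFunctions.SelbergOmega.norm_offA_le`), a zero near the window costs at
most `2π D₀ δ_ρ e^{τ δ_ρ/4}` (`integral_norm_offA_le_near`) and a zero at distance `≥ T` from `3T/2`
costs `O(T e^{τ/8}/(τ (γ − 3T/2)²))` (`integral_norm_offA_le_far`); summing the far zeros against
the local counts (`ZetaZeroOrdinateSums.lean`) gives `O(√T e^{τ/8} log T/τ)`, and the near zeros
are left as the finite sum `∑_{T/2 < γ < 5T/2} m(ρ) δ_ρ e^{τδ_ρ/4}` — the input of Selberg's density
theorem (`exists_offLine_L1_bound`). Finally `integral_le_offLineSum` turns a pointwise domination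
by `∑_ρ m(ρ)(‖𝒜_ρ(u+h)‖ + ‖𝒜_ρ(u)‖)` into an integrated one (Tonelli for series).

## References

* E. C. Titchmarsh, *The Theory of the Riemann Zeta-Function*, 2nd ed. (1986), §9.26.
  [cite: Titchmarsh1986, §9.26]
* K.-M. Tsang, *Some Ω-theorems for the Riemann zeta-function*, Acta Arith. 46 (1986), Lemma 5.
-/

noncomputable section

open Complex Real MeasureTheory Set Filter intervalIntegral
open scoped Topology ENNReal

namespace Literature.NumberTheory.LFunctions.SelbergDelta

open Literature.NumberTheory.LFunctions.SelbergOmega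
open Literature.NumberTheory.LFunctions.ZeroOrdinateSums

/-! ### Per-zero integrals -/

/-- `∫ τ/(1 + τ²(γ − t)²) dt = π` (`τ > 0`). [folklore] -/
theorem integral_tau_div (γ : ℝ) {τ : ℝ} (hτ : 0 < τ) : ∫ t : ℝ, τ / (1 + (τ * (γ - t)) ^ 2) = π := by
  have h1 : ∫ t : ℝ, τ / (1 + (τ * (γ - t)) ^ 2) = ∫ x : ℝ, τ / (1 + (τ * x) ^ 2) := by
    rw [← integral_sub_left_eq_self (fun x : ℝ => τ / (1 + (τ * x) ^ 2)) volume γ]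
  rw [h1]
  have h2 := MeasureTheory.Measure.integral_comp_mul_left (fun y : ℝ => τ / (1 + y ^ 2)) τ
  rw [abs_inv, abs_of_pos hτ] at h2
  rw [h2]
  have e : ∀ y : ℝ, τ / (1 + y ^ 2) = τ * (1 + y ^ 2)⁻¹ := fun y => by rw [div_eq_mul_inv]
  simp_rw [e, MeasureTheory.integral_const_mul, integral_univ_inv_one_add_sq, smul_eq_mul]
  field_simp

/-- Near-zero cost: `∫_a^b ‖𝒜_ρ(u + s)‖ du ≤ π D₀ δ_ρ e^{τδ_ρ/4}` (`a ≤ b`, `τ > 0`). [folklore] -/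
theorem integral_norm_offA_shift_le {τ : ℝ} (hτ : 0 < τ) (ρ : ℂ) (s : ℝ) {a b : ℝ} (hab : a ≤ b) :
    ∫ u in a..b, ‖offA τ ρ (u + s)‖ ≤ π * decayD0 * (|ρ.re - 1 / 2| * Real.exp (τ * |ρ.re - 1 / 2| / 4)) := by
  have hD := decayD0_nonneg
  set δ := |ρ.re - 1 / 2| with hδ
  set B : ℝ → ℝ := fun u => δ * (Real.exp (τ * δ / 4) * decayD0) * (τ / (1 + (τ * (ρ.im - s - u)) ^ 2)) with hB
  have hpt : ∀ u : ℝ, ‖offA τ ρ (u + s)‖ ≤ B u := by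
    intro u
    have := norm_offA_le hτ ρ (u + s)
    rw [hB]; simp only
    rw [show ρ.im - s - u = ρ.im - (u + s) by ring]
    calc ‖offA τ ρ (u + s)‖ ≤ |ρ.re - 1 / 2| * (τ * Real.exp (τ * |ρ.re - 1 / 2| / 4) * decayD0 / (1 + (τ * (ρ.im - (u + s))) ^ 2)) := this
      _ = _ := by rw [← hδ]; ring
  have hBint : Integrable B := by
    have h0 : Integrable fun u : ℝ => τ / (1 + (τ * (ρ.im - s - u)) ^ 2) := by
      have h1 : Integrable fun x : ℝ => τ / (1 + (τ * x) ^ 2) := by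
        refine (integrable_inv_one_add_sq.comp_mul_left' (ne_of_gt hτ)).const_mul τ |>.congr ?_
        exact ae_of_all _ fun x => by simp [div_eq_mul_inv]
      simpa using h1.comp_sub_left (ρ.im - s)
    exact h0.const_mul _
  have hcont : Continuous fun u : ℝ => ‖offA τ ρ (u + s)‖ := ((continuous_offA hτ ρ).comp (continuous_id.add continuous_const)).norm
  calc ∫ u in a..b, ‖offA τ ρ (u + s)‖ ≤ ∫ u in a..b, B u :=
        intervalIntegral.integral_mono_on hab (hcont.intervalIntegrable _ _) (hBint.intervalIntegrable) fun u _ => hpt u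
    _ ≤ ∫ u, B u := by
        rw [intervalIntegral.integral_of_le hab]
        exact setIntegral_le_integral hBint (ae_of_all _ fun u => by rw [hB]; positivity)
    _ = δ * (Real.exp (τ * δ / 4) * decayD0) * π := by
        rw [hB]; simp only
        rw [MeasureTheory.integral_const_mul]
        congr 1
        have := integral_tau_div (ρ.im - s) hτ
        simpa using this
    _ = _ := by ring

/-- Far-zero cost: for `T ≥ 200`, `0 ≤ s ≤ 1`, `τ ≥ 1`, `|γ − 3T/2| ≥ T`:
`∫_{9T/8}^{15T/8} ‖𝒜_ρ(u+s)‖ du ≤ 6 T e^{τ/8} D₀/(τ (γ − 3T/2)²)`. [folklore] -/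
theorem integral_norm_offA_shift_le_far {τ : ℝ} (hτ : 1 ≤ τ) {ρ : ℂ} (hρ : ρ ∈ ZetaZeros.riemannZetaNontrivialZeros)
    {T s : ℝ} (hT : 200 ≤ T) (hs : 0 ≤ s) (hs1 : s ≤ 1) (hfar : T ≤ |ρ.im - 3 * T / 2|) :
    ∫ u in (9 * T / 8)..(15 * T / 8), ‖offA τ ρ (u + s)‖ ≤ 6 * T * Real.exp (τ / 8) * decayD0 / (τ * (ρ.im - 3 * T / 2) ^ 2) := by
  have hτ0 : 0 < τ := by linarith
  have hD := decayD0_nonneg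
  have hW : 9 * T / 8 ≤ 15 * T / 8 := by linarith
  set c := 3 * T / 2 with hc
  have hd0 : 0 < |ρ.im - c| := by linarith
  -- pointwise on the window: `‖𝒜_ρ(u+s)‖ ≤ 8 e^{τ/8} D₀ /(τ (γ − c)²)`
  have hpt : ∀ u ∈ Set.uIoc (9 * T / 8) (15 * T / 8), ‖(fun u => ‖offA τ ρ (u + s)‖) u‖ ≤
      8 * Real.exp (τ / 8) * decayD0 / (τ * (ρ.im - c) ^ 2) := by
    intro u hu
    rw [Set.uIoc_of_le hW] at hu
    rw [Real.norm_eq_abs, abs_of_nonneg (norm_nonneg _)]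
    have h := norm_offA_le hτ0 ρ (u + s)
    have h0r := ZetaZeros.riemannZetaNontrivialZeros.re_pos hρ
    have h1r := ZetaZeros.riemannZetaNontrivialZeros.re_lt_one hρ
    have hδ : |ρ.re - 1 / 2| ≤ 1 / 2 := abs_le.2 ⟨by linarith, by linarith⟩
    have hexp : Real.exp (τ * |ρ.re - 1 / 2| / 4) ≤ Real.exp (τ / 8) := Real.exp_le_exp.2 (by nlinarith)
    have hstep : ‖offA τ ρ (u + s)‖ ≤ 1 / 2 * (τ * Real.exp (τ / 8) * decayD0 / (1 + (τ * (ρ.im - (u + s))) ^ 2)) := by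
      refine h.trans (mul_le_mul hδ ?_ (by positivity) (by norm_num))
      gcongr
    refine hstep.trans ?_
    -- `|γ − (u+s)| ≥ |γ − c| − 3T/8 − 1 ≥ |γ − c|/4`
    have hdist : |ρ.im - c| / 4 ≤ |ρ.im - (u + s)| := by
      have h1 : |ρ.im - c| ≤ |ρ.im - (u + s)| + |u + s - c| := by
        have := abs_sub_le ρ.im (u + s) c; linarith
      have h2 : |u + s - c| ≤ 3 * T / 8 + 1 := by
        rw [abs_le]; constructor <;> [skip; skip] <;> rw [hc] <;> linarith [hu.1, hu.2]
      linarith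
    have hsq : (ρ.im - c) ^ 2 / 16 ≤ (ρ.im - (u + s)) ^ 2 := by
      rw [← sq_abs (ρ.im - c), ← sq_abs (ρ.im - (u + s))]
      nlinarith [abs_nonneg (ρ.im - c), abs_nonneg (ρ.im - (u + s))]
    have hsq' : τ ^ 2 * (ρ.im - c) ^ 2 / 16 ≤ 1 + (τ * (ρ.im - (u + s))) ^ 2 := by
      rw [mul_pow]; nlinarith [sq_nonneg τ]
    have hpos : 0 < τ * (ρ.im - c) ^ 2 := by have := sq_pos_iff.2 (abs_pos.1 hd0); positivity
    rw [← mul_div_assoc, div_le_div_iff₀ (by positivity) hpos]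
    have h0 : 0 ≤ Real.exp (τ / 8) * decayD0 := by positivity
    calc 1 / 2 * (τ * Real.exp (τ / 8) * decayD0) * (τ * (ρ.im - c) ^ 2)
        = 8 * (Real.exp (τ / 8) * decayD0) * (τ ^ 2 * (ρ.im - c) ^ 2 / 16) := by ring
      _ ≤ 8 * (Real.exp (τ / 8) * decayD0) * (1 + (τ * (ρ.im - (u + s))) ^ 2) :=
          mul_le_mul_of_nonneg_left hsq' (by positivity)
      _ = _ := by ring
  have := intervalIntegral.norm_integral_le_of_norm_le_const hpt
  rw [show |15 * T / 8 - 9 * T / 8| = 3 * T / 4 by rw [abs_of_nonneg (by linarith)]; ring] at this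
  rw [Real.norm_eq_abs, abs_of_nonneg (intervalIntegral.integral_nonneg hW fun u _ => norm_nonneg _)] at this
  calc ∫ u in (9 * T / 8)..(15 * T / 8), ‖offA τ ρ (u + s)‖ ≤ 8 * Real.exp (τ / 8) * decayD0 / (τ * (ρ.im - c) ^ 2) * (3 * T / 4) := this
    _ = 6 * T * Real.exp (τ / 8) * decayD0 / (τ * (ρ.im - 3 * T / 2) ^ 2) := by rw [hc]; ring

/-! ### The `L¹` bound of the off-line sum over the window -/

/-- The per-zero window integral `I_ρ = ∫_{9T/8}^{15T/8} (‖𝒜_ρ(u+h)‖ + ‖𝒜_ρ(u)‖) du` is at most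
`2π D₀ δ_ρ e^{τδ_ρ/4}`. [folklore] -/
theorem perZero_le_near {τ : ℝ} (hτ : 0 < τ) (ρ : ℂ) {T h : ℝ} (hT : 0 ≤ T) :
    ∫ u in (9 * T / 8)..(15 * T / 8), (‖offA τ ρ (u + h)‖ + ‖offA τ ρ u‖) ≤
      2 * π * decayD0 * (|ρ.re - 1 / 2| * Real.exp (τ * |ρ.re - 1 / 2| / 4)) := by
  have hW : 9 * T / 8 ≤ 15 * T / 8 := by linarith
  have hc1 : Continuous fun u : ℝ => ‖offA τ ρ (u + h)‖ := ((continuous_offA hτ ρ).comp (continuous_id.add continuous_const)).norm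
  have hc2 : Continuous fun u : ℝ => ‖offA τ ρ u‖ := (continuous_offA hτ ρ).norm
  rw [intervalIntegral.integral_add (hc1.intervalIntegrable _ _) (hc2.intervalIntegrable _ _)]
  have h1 := integral_norm_offA_shift_le hτ ρ h hW
  have h2 := integral_norm_offA_shift_le hτ ρ 0 hW
  simp only [add_zero] at h2
  linarith

/-- The same for a far zero (`|γ − 3T/2| ≥ T`): `I_ρ ≤ 12 T e^{τ/8} D₀/(τ(γ − 3T/2)²)`. [folklore] -/
theorem perZero_le_far {τ : ℝ} (hτ : 1 ≤ τ) {ρ : ℂ} (hρ : ρ ∈ ZetaZeros.riemannZetaNontrivialZeros)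
    {T h : ℝ} (hT : 200 ≤ T) (hh : 0 ≤ h) (hh1 : h ≤ 1) (hfar : T ≤ |ρ.im - 3 * T / 2|) :
    ∫ u in (9 * T / 8)..(15 * T / 8), (‖offA τ ρ (u + h)‖ + ‖offA τ ρ u‖) ≤
      12 * T * Real.exp (τ / 8) * decayD0 / (τ * (ρ.im - 3 * T / 2) ^ 2) := by
  have hτ0 : 0 < τ := by linarith
  have hc1 : Continuous fun u : ℝ => ‖offA τ ρ (u + h)‖ := ((continuous_offA hτ0 ρ).comp (continuous_id.add continuous_const)).norm
  have hc2 : Continuous fun u : ℝ => ‖offA τ ρ u‖ := (continuous_offA hτ0 ρ).norm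
  rw [intervalIntegral.integral_add (hc1.intervalIntegrable _ _) (hc2.intervalIntegrable _ _)]
  have h1 := integral_norm_offA_shift_le_far hτ hρ hT hh hh1 hfar
  have h2 := integral_norm_offA_shift_le_far hτ hρ hT le_rfl zero_le_one hfar
  simp only [add_zero] at h2
  have : 12 * T * Real.exp (τ / 8) * decayD0 / (τ * (ρ.im - 3 * T / 2) ^ 2) =
      2 * (6 * T * Real.exp (τ / 8) * decayD0 / (τ * (ρ.im - 3 * T / 2) ^ 2)) := by ring
  linarith

open Classical in
/-- **The `L¹` bound of the off-line sum over `u ∈ [9T/8, 15T/8]`.** There is `C_far > 0` such that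
for `T ≥ 200`, `0 ≤ h ≤ 1`, `τ ≥ 1`: the per-zero window integrals are summable against `m(ρ)` and
`∑_ρ m(ρ) ∫_{9T/8}^{15T/8} (‖𝒜_ρ(u+h)‖ + ‖𝒜_ρ(u)‖) du`
`  ≤ 2π D₀ ∑_{ρ ∈ box(5T/2), γ > T/2} m(ρ) δ_ρ e^{τδ_ρ/4} + C_far √T e^{τ/8} (log T + 3)/τ`
(the finite sum — the input of the density theorem — runs over the zeros with `T/2 < γ ≤ 5T/2`).
[cite: Titchmarsh1986, §9.26] -/
theorem exists_offLine_L1_bound : ∃ C : ℝ, 0 < C ∧ ∀ (T h τ : ℝ), 200 ≤ T → 0 ≤ h → h ≤ 1 → 1 ≤ τ →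
    Summable (fun ρ : ZetaZeros.riemannZetaNontrivialZeros => (riemannZetaZeroOrder (ρ : ℂ) : ℝ) *
      ∫ u in (9 * T / 8)..(15 * T / 8), (‖offA τ ρ (u + h)‖ + ‖offA τ ρ u‖)) ∧
    ∑' ρ : ZetaZeros.riemannZetaNontrivialZeros, (riemannZetaZeroOrder (ρ : ℂ) : ℝ) *
        ∫ u in (9 * T / 8)..(15 * T / 8), (‖offA τ ρ (u + h)‖ + ‖offA τ ρ u‖) ≤
      2 * π * decayD0 * ∑ ρ ∈ ((zetaZeroBox_finite 0 (5 * T / 2)).toFinset.filter (fun ρ => T / 2 < ρ.im)),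
          (riemannZetaZeroOrder ρ : ℝ) * (|ρ.re - 1 / 2| * Real.exp (τ * |ρ.re - 1 / 2| / 4)) +
      C * Real.sqrt T * Real.exp (τ / 8) * (Real.log T + 3) / τ := by
  obtain ⟨Cw, hCw0, hCw⟩ := exists_sum_le_of_abs_im_sub_le
  have hD := decayD0_nonneg
  refine ⟨Cw * (48 * decayD0) * 12 * 2 + 1, by positivity, ?_⟩
  intro T h τ hT hh hh1 hτ
  have hτ0 : 0 < τ := by linarith
  have hT0 : 0 < T := by linarith
  set c := 3 * T / 2 with hc
  set R := T / 2 with hR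
  have hR4 : 4 ≤ R := by rw [hR]; linarith
  set Fn := (zetaZeroBox_finite 0 (5 * T / 2)).toFinset.filter (fun ρ => T / 2 < ρ.im) with hFn
  set Iρ : ℂ → ℝ := fun ρ => ∫ u in (9 * T / 8)..(15 * T / 8), (‖offA τ ρ (u + h)‖ + ‖offA τ ρ u‖) with hI
  have hI0 : ∀ ρ : ℂ, 0 ≤ Iρ ρ := fun ρ => intervalIntegral.integral_nonneg (by linarith) fun u _ => by positivity
  -- near/far decomposition of the per-zero integral
  set nearB : ℂ → ℝ := fun ρ => if ρ ∈ Fn then 2 * π * decayD0 * (|ρ.re - 1 / 2| * Real.exp (τ * |ρ.re - 1 / 2| / 4)) else 0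
    with hnearB
  set farB : ℂ → ℝ := fun ρ => if ρ ∈ Fn then 0 else 12 * T * Real.exp (τ / 8) * decayD0 / (τ * (ρ.im - c) ^ 2) with hfarB
  have hmemFn : ∀ ρ ∈ ZetaZeros.riemannZetaNontrivialZeros, ρ ∉ Fn → T ≤ |ρ.im - c| := by
    intro ρ hρ hnot
    rw [hFn, Finset.mem_filter, Set.Finite.mem_toFinset] at hnot
    have hz := ZetaZeros.riemannZetaNontrivialZeros.zeta_eq_zero hρ
    have h0 := ZetaZeros.riemannZetaNontrivialZeros.re_pos hρ
    have h1 := ZetaZeros.riemannZetaNontrivialZeros.re_lt_one hρ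
    by_cases hlow : ρ.im ≤ T / 2
    · rw [abs_of_nonpos (by rw [hc]; linarith)]; rw [hc]; linarith
    · push Not at hlow
      have hhigh : ¬ ρ.im ≤ 5 * T / 2 := by
        intro h5; exact hnot ⟨⟨hz, h0.le, h1.le, by linarith, h5⟩, hlow⟩
      push Not at hhigh
      rw [abs_of_nonneg (by rw [hc]; linarith)]; rw [hc]; linarith
  have hsplit : ∀ ρ ∈ ZetaZeros.riemannZetaNontrivialZeros, Iρ ρ ≤ nearB ρ + farB ρ := by
    intro ρ hρ
    by_cases hmem : ρ ∈ Fn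
    · simp only [hnearB, hfarB, if_pos hmem, add_zero]
      exact perZero_le_near hτ0 ρ hT0.le
    · simp only [hnearB, hfarB, if_neg hmem, zero_add]
      exact perZero_le_far hτ hρ hT hh hh1 (hmemFn ρ hρ hmem)
  -- the far part against the ordinate majorant
  set ψ : ℤ → ℝ := fun k => (48 * T * Real.exp (τ / 8) * decayD0 / τ) / (max (|(k : ℝ) - c|) R) ^ 2 with hψ
  have hψ0 : ∀ k, 0 ≤ ψ k := fun k => by rw [hψ]; positivity
  have hfar0 : ∀ ρ ∈ ZetaZeros.riemannZetaNontrivialZeros, 0 ≤ farB ρ := fun ρ _ => by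
    simp only [hfarB]; split_ifs <;> positivity
  have hfarψ : ∀ ρ ∈ ZetaZeros.riemannZetaNontrivialZeros, farB ρ ≤ ψ (round ρ.im) := by
    intro ρ hρ
    by_cases hmem : ρ ∈ Fn
    · simp only [hfarB, if_pos hmem]; exact hψ0 _
    · simp only [hfarB, if_neg hmem, hψ]
      have hd := hmemFn ρ hρ hmem
      set k := round ρ.im with hk
      have hkγ : |(k : ℝ) - ρ.im| ≤ 1 / 2 := by have := abs_sub_round ρ.im; rwa [abs_sub_comm]
      have hmax : max (|(k : ℝ) - c|) R ≤ 2 * |ρ.im - c| := by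
        refine max_le ?_ (by rw [hR]; linarith)
        have := abs_sub_le (k : ℝ) ρ.im c; linarith
      have hmpos : 0 < max (|(k : ℝ) - c|) R := lt_of_lt_of_le (by linarith) (le_max_right _ _)
      have hne : (ρ.im - c) ^ 2 ≠ 0 := by
        intro h0; rw [sq_eq_zero_iff] at h0; rw [h0, abs_zero] at hd; linarith
      have hpos : 0 < τ * (ρ.im - c) ^ 2 := by have := lt_of_le_of_ne (sq_nonneg (ρ.im - c)) (Ne.symm hne); positivity
      rw [div_div, div_le_div_iff₀ hpos (by positivity)]
      have hsq : (max (|(k : ℝ) - c|) R) ^ 2 ≤ 4 * (ρ.im - c) ^ 2 := by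
        rw [← sq_abs (ρ.im - c)]; nlinarith [hmpos.le, abs_nonneg (ρ.im - c)]
      have h0 : 0 ≤ T * Real.exp (τ / 8) * decayD0 := by positivity
      nlinarith [mul_le_mul_of_nonneg_left hsq h0]
  have hΨ : ∀ K : Finset ℤ, ∑ k ∈ K, ψ k * Real.log (|(k : ℝ)| + 2) ≤
      (48 * decayD0 * 12 * 2) * Real.sqrt T * Real.exp (τ / 8) * (Real.log T + 3) / τ := by
    intro K
    have hs := sum_log_div_max_sq_le K c hR4
    have heq : ∑ k ∈ K, ψ k * Real.log (|(k : ℝ)| + 2) =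
        (48 * T * Real.exp (τ / 8) * decayD0 / τ) * ∑ k ∈ K, Real.log (|(k : ℝ)| + 2) / (max (|(k : ℝ) - c|) R) ^ 2 := by
      rw [Finset.mul_sum]; refine Finset.sum_congr rfl fun k _ => ?_; simp only [hψ]; ring
    rw [heq]
    have hlogc : Real.log (|c| + 2) + 2 ≤ Real.log T + 3 := by
      rw [hc, abs_of_pos (by positivity)]
      have : Real.log (3 * T / 2 + 2) ≤ Real.log (Real.exp 1 * T) := by
        refine Real.log_le_log (by positivity) ?_
        have := Real.exp_one_gt_d9; nlinarith
      rw [Real.log_mul (Real.exp_pos 1).ne' hT0.ne', Real.log_exp] at this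
      linarith
    have hsqrtR : Real.sqrt T ≤ 2 * Real.sqrt R := by
      rw [hR, show 2 * Real.sqrt (T / 2) = Real.sqrt (4 * (T / 2)) by
        rw [Real.sqrt_mul (by norm_num), show Real.sqrt 4 = 2 by
          rw [show (4:ℝ) = 2 ^ 2 by norm_num, Real.sqrt_sq (by norm_num)]]]
      exact Real.sqrt_le_sqrt (by linarith)
    have hsR : 0 < Real.sqrt R := Real.sqrt_pos.2 (by linarith)
    have hsT : 0 < Real.sqrt T := Real.sqrt_pos.2 hT0
    have hstep : 12 * (Real.log (|c| + 2) + 2) / Real.sqrt R ≤ 24 * (Real.log T + 3) / Real.sqrt T := by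
      have hl0 : 0 ≤ Real.log (|c| + 2) + 2 := by
        have := Real.log_nonneg (show (1:ℝ) ≤ |c| + 2 by linarith [abs_nonneg c]); linarith
      rw [div_le_div_iff₀ hsR hsT]
      calc 12 * (Real.log (|c| + 2) + 2) * Real.sqrt T ≤ 12 * (Real.log T + 3) * (2 * Real.sqrt R) :=
            mul_le_mul (by linarith) hsqrtR hsT.le (by linarith)
        _ = 24 * (Real.log T + 3) * Real.sqrt R := by ring
    have hfac : 0 ≤ 48 * T * Real.exp (τ / 8) * decayD0 / τ := by positivity
    calc (48 * T * Real.exp (τ / 8) * decayD0 / τ) * ∑ k ∈ K, Real.log (|(k : ℝ)| + 2) / (max (|(k : ℝ) - c|) R) ^ 2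
        ≤ (48 * T * Real.exp (τ / 8) * decayD0 / τ) * (24 * (Real.log T + 3) / Real.sqrt T) :=
          mul_le_mul_of_nonneg_left (hs.trans hstep) hfac
      _ = (48 * decayD0 * 12 * 2) * (T / Real.sqrt T) * Real.exp (τ / 8) * (Real.log T + 3) / τ := by ring
      _ = (48 * decayD0 * 12 * 2) * Real.sqrt T * Real.exp (τ / 8) * (Real.log T + 3) / τ := by
          rw [Real.div_sqrt]
  obtain ⟨hsum_far, hle_far⟩ := tsum_mul_le_of_ordinate_majorant hCw0.le hCw hψ0 hfar0 hfarψ hΨ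
  -- the near part: finite support
  set Fn' : Finset ZetaZeros.riemannZetaNontrivialZeros := Fn.subtype (· ∈ ZetaZeros.riemannZetaNontrivialZeros) with hFn'
  have hnear_zero : ∀ ρ : ZetaZeros.riemannZetaNontrivialZeros, ρ ∉ Fn' →
      (riemannZetaZeroOrder (ρ : ℂ) : ℝ) * nearB ρ = 0 := by
    intro ρ hρ
    rw [hFn', Finset.mem_subtype] at hρ
    simp only [hnearB, if_neg hρ, mul_zero]
  have hsum_near : Summable fun ρ : ZetaZeros.riemannZetaNontrivialZeros => (riemannZetaZeroOrder (ρ : ℂ) : ℝ) * nearB ρ :=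
    summable_of_ne_finset_zero hnear_zero
  have htsum_near : ∑' ρ : ZetaZeros.riemannZetaNontrivialZeros, (riemannZetaZeroOrder (ρ : ℂ) : ℝ) * nearB ρ =
      2 * π * decayD0 * ∑ ρ ∈ Fn, (riemannZetaZeroOrder ρ : ℝ) * (|ρ.re - 1 / 2| * Real.exp (τ * |ρ.re - 1 / 2| / 4)) := by
    rw [tsum_eq_sum hnear_zero, hFn', Finset.sum_subtype_eq_sum_filter (f := fun x : ℂ => (riemannZetaZeroOrder x : ℝ) * nearB x)]
    have hfil : Fn.filter (· ∈ ZetaZeros.riemannZetaNontrivialZeros) = Fn := by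
      refine Finset.filter_true_of_mem fun ρ hρ => ?_
      rw [hFn, Finset.mem_filter, Set.Finite.mem_toFinset] at hρ
      exact ZetaZeros.riemannZetaNontrivialZeros.mem_of_im_ne_zero hρ.1.1 hρ.1.2.2.2.1.ne'
    rw [hfil, Finset.mul_sum]
    refine Finset.sum_congr rfl fun ρ hρ => ?_
    simp only [hnearB, if_pos hρ]; ring
  -- summability of `m I` and the bound
  have hmnn : ∀ ρ : ZetaZeros.riemannZetaNontrivialZeros, (0 : ℝ) ≤ riemannZetaZeroOrder (ρ : ℂ) := fun ρ =>
    riemannZetaZeroOrder_nonneg_of_zero (ZetaZeros.riemannZetaNontrivialZeros.zeta_eq_zero ρ.2)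
  have hle_pt : ∀ ρ : ZetaZeros.riemannZetaNontrivialZeros, (riemannZetaZeroOrder (ρ : ℂ) : ℝ) * Iρ ρ ≤
      (riemannZetaZeroOrder (ρ : ℂ) : ℝ) * nearB ρ + (riemannZetaZeroOrder (ρ : ℂ) : ℝ) * farB ρ := by
    intro ρ; rw [← mul_add]; exact mul_le_mul_of_nonneg_left (hsplit ρ ρ.2) (hmnn ρ)
  have hsumI : Summable fun ρ : ZetaZeros.riemannZetaNontrivialZeros => (riemannZetaZeroOrder (ρ : ℂ) : ℝ) * Iρ ρ :=
    Summable.of_nonneg_of_le (fun ρ => mul_nonneg (hmnn ρ) (hI0 _)) hle_pt (hsum_near.add hsum_far)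
  refine ⟨hsumI, ?_⟩
  calc ∑' ρ : ZetaZeros.riemannZetaNontrivialZeros, (riemannZetaZeroOrder (ρ : ℂ) : ℝ) * Iρ ρ
      ≤ ∑' ρ : ZetaZeros.riemannZetaNontrivialZeros, ((riemannZetaZeroOrder (ρ : ℂ) : ℝ) * nearB ρ + (riemannZetaZeroOrder (ρ : ℂ) : ℝ) * farB ρ) :=
        hsumI.tsum_le_tsum hle_pt (hsum_near.add hsum_far)
    _ = (∑' ρ : ZetaZeros.riemannZetaNontrivialZeros, (riemannZetaZeroOrder (ρ : ℂ) : ℝ) * nearB ρ) +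
          ∑' ρ : ZetaZeros.riemannZetaNontrivialZeros, (riemannZetaZeroOrder (ρ : ℂ) : ℝ) * farB ρ := hsum_near.tsum_add hsum_far
    _ ≤ 2 * π * decayD0 * ∑ ρ ∈ Fn, (riemannZetaZeroOrder ρ : ℝ) * (|ρ.re - 1 / 2| * Real.exp (τ * |ρ.re - 1 / 2| / 4)) +
          Cw * ((48 * decayD0 * 12 * 2) * Real.sqrt T * Real.exp (τ / 8) * (Real.log T + 3) / τ) := by
        rw [htsum_near]; linarith
    _ ≤ _ := by
        have hlog3 : 0 ≤ Real.log T + 3 := by have := Real.log_nonneg (show (1:ℝ) ≤ T by linarith); linarith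
        have h0 : 0 ≤ Real.sqrt T * Real.exp (τ / 8) * (Real.log T + 3) / τ := by positivity
        have e1 : Cw * ((48 * decayD0 * 12 * 2) * Real.sqrt T * Real.exp (τ / 8) * (Real.log T + 3) / τ) =
            (Cw * (48 * decayD0) * 12 * 2) * (Real.sqrt T * Real.exp (τ / 8) * (Real.log T + 3) / τ) := by ring
        have e2 : (Cw * (48 * decayD0) * 12 * 2 + 1) * Real.sqrt T * Real.exp (τ / 8) * (Real.log T + 3) / τ =
            (Cw * (48 * decayD0) * 12 * 2 + 1) * (Real.sqrt T * Real.exp (τ / 8) * (Real.log T + 3) / τ) := by ring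
        rw [e1, e2]
        nlinarith

/-! ### From a pointwise domination by the off-line sum to an integrated one -/

/-- **Tonelli for the off-line majorant.** If `φ` is continuous on `[a, b]` (`a ≤ b`) and
`φ(u) ≤ ∑_ρ m(ρ) (‖𝒜_ρ(u+h)‖ + ‖𝒜_ρ(u)‖)` there, and the per-zero integrals
`∫_a^b (‖𝒜_ρ(u+h)‖ + ‖𝒜_ρ(u)‖) du` are summable against `m(ρ)`, then
`∫_a^b φ ≤ ∑_ρ m(ρ) ∫_a^b (‖𝒜_ρ(u+h)‖ + ‖𝒜_ρ(u)‖) du` (`τ ≥ 1`). [folklore] -/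
theorem integral_le_offLineSum {τ : ℝ} (hτ : 1 ≤ τ) {a b h : ℝ} (hab : a ≤ b) {φ : ℝ → ℝ}
    (hφ : ContinuousOn φ (Set.Icc a b))
    (hle : ∀ u ∈ Set.Icc a b, φ u ≤ ∑' ρ : ZetaZeros.riemannZetaNontrivialZeros,
      (riemannZetaZeroOrder (ρ : ℂ) : ℝ) * (‖offA τ ρ (u + h)‖ + ‖offA τ ρ u‖))
    (hsum : Summable fun ρ : ZetaZeros.riemannZetaNontrivialZeros => (riemannZetaZeroOrder (ρ : ℂ) : ℝ) *
      ∫ u in a..b, (‖offA τ ρ (u + h)‖ + ‖offA τ ρ u‖)) :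
    ∫ u in a..b, φ u ≤ ∑' ρ : ZetaZeros.riemannZetaNontrivialZeros, (riemannZetaZeroOrder (ρ : ℂ) : ℝ) *
      ∫ u in a..b, (‖offA τ ρ (u + h)‖ + ‖offA τ ρ u‖) := by
  have hτ0 : 0 < τ := by linarith
  set g : ZetaZeros.riemannZetaNontrivialZeros → ℝ → ℝ := fun ρ u =>
    (riemannZetaZeroOrder (ρ : ℂ) : ℝ) * (‖offA τ ρ (u + h)‖ + ‖offA τ ρ u‖) with hg
  have hmnn : ∀ ρ : ZetaZeros.riemannZetaNontrivialZeros, (0 : ℝ) ≤ riemannZetaZeroOrder (ρ : ℂ) := fun ρ =>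
    riemannZetaZeroOrder_nonneg_of_zero (ZetaZeros.riemannZetaNontrivialZeros.zeta_eq_zero ρ.2)
  have hg0 : ∀ ρ u, 0 ≤ g ρ u := fun ρ u => by simp only [hg]; exact mul_nonneg (hmnn ρ) (by positivity)
  have hgc : ∀ ρ, Continuous (g ρ) := fun ρ => continuous_const.mul
    ((((continuous_offA hτ0 ρ).comp (continuous_id.add continuous_const)).norm).add (continuous_offA hτ0 ρ).norm)
  -- per-zero: `∫ g ρ = m ∫ (…)`
  have hgint : ∀ ρ, ∫ u in a..b, g ρ u = (riemannZetaZeroOrder (ρ : ℂ) : ℝ) * ∫ u in a..b, (‖offA τ ρ (u + h)‖ + ‖offA τ ρ u‖) :=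
    fun ρ => by simp only [hg]; rw [intervalIntegral.integral_const_mul]
  -- work with lintegrals on `Ioc a b`
  set μ := (volume : Measure ℝ).restrict (Set.Ioc a b) with hμ
  have hstep1 : ∫⁻ u, ENNReal.ofReal (φ u) ∂μ ≤ ∫⁻ u, ∑' ρ, ENNReal.ofReal (g ρ u) ∂μ := by
    refine lintegral_mono_ae ?_
    rw [hμ, ae_restrict_iff' measurableSet_Ioc]
    refine ae_of_all _ fun u hu => ?_
    have hu' : u ∈ Set.Icc a b := ⟨hu.1.le, hu.2⟩
    have hsumu : Summable fun ρ : ZetaZeros.riemannZetaNontrivialZeros => g ρ u := by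
      have hs := ((summable_zeroOrder_div_one_add_sub_sq (u + h)).add (summable_zeroOrder_div_one_add_sub_sq u)).mul_left
        (τ / 2 * Real.exp (τ / 8) * decayD0)
      refine Summable.of_nonneg_of_le (fun ρ => hg0 ρ u) (fun ρ => ?_) hs
      simp only [hg]
      have h1 := norm_offA_le' hτ ρ.2 (u + h)
      have h2 := norm_offA_le' hτ ρ.2 u
      calc (riemannZetaZeroOrder (ρ : ℂ) : ℝ) * (‖offA τ ρ (u + h)‖ + ‖offA τ ρ u‖)
          ≤ (riemannZetaZeroOrder (ρ : ℂ) : ℝ) * (τ / 2 * Real.exp (τ / 8) * decayD0 / (1 + ((ρ : ℂ).im - (u + h)) ^ 2) +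
              τ / 2 * Real.exp (τ / 8) * decayD0 / (1 + ((ρ : ℂ).im - u) ^ 2)) := mul_le_mul_of_nonneg_left (add_le_add h1 h2) (hmnn ρ)
        _ = _ := by ring
    rw [← ENNReal.ofReal_tsum_of_nonneg (fun ρ => hg0 ρ u) hsumu]
    exact ENNReal.ofReal_le_ofReal ((hle u hu').trans_eq (by simp only [hg]))
  have hstep2 : ∫⁻ u, ∑' ρ, ENNReal.ofReal (g ρ u) ∂μ = ∑' ρ, ∫⁻ u, ENNReal.ofReal (g ρ u) ∂μ :=
    lintegral_tsum fun ρ => ((hgc ρ).measurable.ennreal_ofReal).aemeasurable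
  have hstep3 : ∀ ρ, ∫⁻ u, ENNReal.ofReal (g ρ u) ∂μ = ENNReal.ofReal (∫ u in a..b, g ρ u) := by
    intro ρ
    rw [intervalIntegral.integral_of_le hab, ← hμ,
      ← ofReal_integral_eq_lintegral_ofReal ((hgc ρ).integrableOn_Icc.mono_set Set.Ioc_subset_Icc_self)
        (ae_of_all _ fun u => hg0 ρ u)]
  have hsum' : Summable fun ρ : ZetaZeros.riemannZetaNontrivialZeros => ∫ u in a..b, g ρ u := by
    simpa only [hgint] using hsum
  have hnn' : ∀ ρ : ZetaZeros.riemannZetaNontrivialZeros, 0 ≤ ∫ u in a..b, g ρ u := fun ρ =>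
    intervalIntegral.integral_nonneg hab fun u _ => hg0 ρ u
  have hchain : ∫⁻ u, ENNReal.ofReal (φ u) ∂μ ≤ ENNReal.ofReal (∑' ρ, ∫ u in a..b, g ρ u) := by
    rw [ENNReal.ofReal_tsum_of_nonneg hnn' hsum']
    simp_rw [← hstep3]
    exact hstep1.trans_eq hstep2
  -- back to real integrals
  rw [intervalIntegral.integral_of_le hab, ← hμ]
  have hφint : Integrable φ μ := by rw [hμ]; exact (hφ.integrableOn_Icc).mono_set Set.Ioc_subset_Icc_self
  calc ∫ u, φ u ∂μ = (∫⁻ u, ENNReal.ofReal (φ u) ∂μ).toReal - (∫⁻ u, ENNReal.ofReal (-φ u) ∂μ).toReal :=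
        integral_eq_lintegral_pos_part_sub_lintegral_neg_part hφint
    _ ≤ (∫⁻ u, ENNReal.ofReal (φ u) ∂μ).toReal := sub_le_self _ ENNReal.toReal_nonneg
    _ ≤ (ENNReal.ofReal (∑' ρ, ∫ u in a..b, g ρ u)).toReal := ENNReal.toReal_mono ENNReal.ofReal_ne_top hchain
    _ = ∑' ρ, ∫ u in a..b, g ρ u := ENNReal.toReal_ofReal (tsum_nonneg hnn')
    _ = _ := by simp only [hgint]

end Literature.NumberTheory.LFunctions.SelbergDelta
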